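import Mathlib
import Summits.Ventures.HodgeRepro.Tier4.Target
import Summits.Ventures.HodgeRepro.Tier4.Common.TargetBall
import Summits.Ventures.HodgeRepro.Tier4.Common.AutForms
import Summits.Ventures.HodgeRepro.Tier4.Line3.KMDatum
import Summits.Ventures.HodgeRepro.Tier4.Line3.KMDatumS
import Summits.Ventures.HodgeRepro.Tier4.Line3.Defs
import Summits.Ventures.HodgeRepro.Tier4.Line3.HeckeEquivarianceLemmas
import Summits.Ventures.HodgeRepro.Tier4.Line3.KernelIntegralPosS
import Summits.Ventures.HodgeRepro.Tier4.Line3.FibreCount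
import Summits.Ventures.HodgeRepro.Tier4.Line3.BallChangeOfVariables
import Summits.Ventures.HodgeRepro.Tier4.Line3.DomainTransfer
import Summits.Ventures.HodgeRepro.Tier4.Line3.KernelEquivariance
import Summits.Ventures.HodgeRepro.Tier4.Line3.CoefInvariance
import Summits.Ventures.HodgeRepro.Tier4.Line3.TorusInvariance
import Summits.Ventures.HodgeRepro.Tier4.Line3.ClassRegrouping
import Summits.Ventures.HodgeRepro.Tier4.Line3.MainClassReps
import Summits.Ventures.HodgeRepro.Tier4.Line3.ClassFibres
import Summits.Ventures.HodgeRepro.Tier4.Line3.CentreFibres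
import Summits.Ventures.HodgeRepro.Tier4.Line3.CentreFinite
import Summits.Ventures.HodgeRepro.Tier4.Line3.BallCoordLemmas
import Summits.Ventures.HodgeRepro.Tier4.Line3.StabFiniteApi
import Summits.Ventures.HodgeRepro.Tier4.Line3.MainTermAssembly
import Summits.Ventures.HodgeRepro.Tier4.Line3.MainTermInterchange

/-!
# Tier4/Line3/KernelIntegrable — the kernel is integrable where the class coefficient does not vanish (L3.6a, R-e)

Blind re-derivation cell `pub-hodge-repro`, Tier 4 «PROVE THE STEP» (README §9–§10), LINE L3, seat t4-L3-p1 (prover);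
the last residual of L3.6a: the hypothesis `hint` (integrability of the kernel on the ball) of `MainTermInterchange.
term_main_unfold_full'` is DERIVED from the majorant `h2` of L3.2a, so that L3.6a holds with exactly the skeleton's
hypotheses (`hab`, `hD`, `h2`).

CONTENT.  (1) The tiling for the Lebesgue integral of non-negative functions (`lintegral_ball_eq_tsum_image`, no
integrability needed) and the change of variables of the ball action for it (`lintegral_image_actM`), hence
`Σ′_{g ∈ Γ′} ∫⁻_D ‖kernel (g • x)‖ₑ = |Z′| · ∫⁻_𝔹 ‖kernel x‖ₑ` (`tsum_lintegral_kernel_mulVec`).  (2) For a main class `c`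
with `coefQ (x_c) ≠ 0`, the finite lintegral of the class-kernel family (`lintegral_tsum_classKernel_ne_top`, from `h2`)
forces `∫⁻_𝔹 ‖kernel x_c‖ₑ < ∞`, i.e. the kernel of `x_c` — hence of `xm` and of every `x_{c′}` — is integrable
(`integrableOn_kernel_of_coefQ_ne_zero`, `integrableOn_kernel_of_mulVec`).  (3) **`term_main_unfold_final`**: if some
class coefficient is non-zero, (2) feeds `term_main_unfold_full'`; otherwise both sides of L3.6a vanish.

Nothing here asserts anything about the truth of (P); HC_CM is NOT proved by anyone in this repository.
-/

set_option autoImplicit false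

noncomputable section

namespace Summit.Ventures.HodgeRepro.Tier4.Line3

open Summit.Ventures.HodgeRepro.Tier4
open Matrix MeasureTheory
open scoped ENNReal ComplexConjugate
open HeckeEquivariance

/-! ## 1. The fibre count and the tiling for `∫⁻` -/

section Fibres

variable {A B : Type*} (F : A → B)

/-- Summing `f ∘ F` is summing `f` over the fibres of `F` (`ℝ≥0∞`, any `f`). -/
theorem tsum_comp_eq_ennreal (f : B → ℝ≥0∞) :
    ∑' a, f (F a) = ∑' b, ∑' _ : {a // F a = b}, f b := by
  rw [← (Equiv.sigmaFiberEquiv F).tsum_eq (fun a => f (F a)), ENNReal.tsum_sigma']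
  refine tsum_congr fun b => tsum_congr fun x => ?_
  rw [show F ((Equiv.sigmaFiberEquiv F) ⟨b, x⟩) = b from x.2]

end Fibres

section ChangeOfVariables

variable {M : Matrix (Fin 3) (Fin 3) ℂ}

/-- The change of variables `z ↦ actM M z` for `∫⁻` over a measurable `D ⊆ 𝔹`, `M ∈ U(2,1)`. -/
theorem lintegral_image_actM (hM : Mᴴ * J * M = J) {D : Set (Fin 2 → ℂ)} (hD : MeasurableSet D) (hDb : D ⊆ ball)
    (g : (Fin 2 → ℂ) → ℝ≥0∞) :
    ∫⁻ w in actM M '' D, g w =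
      ∫⁻ z in D, ENNReal.ofReal (Complex.normSq (jacDetMap (actM M) z)) * g (actM M z) := by
  have hdiff : ∀ z ∈ D, DifferentiableAt ℂ (actM M) z := fun z hz =>
    (differentiableOn_actM hM).differentiableAt (isOpen_ball.mem_nhds (hDb hz))
  have hf' : ∀ z ∈ D, HasFDerivWithinAt (actM M) ((fderiv ℂ (actM M) z).restrictScalars ℝ) D z :=
    fun z hz => ((hdiff z hz).hasFDerivAt.restrictScalars ℝ).hasFDerivWithinAt
  rw [lintegral_image_eq_lintegral_abs_det_fderiv_mul (μ := volume) hD hf' ((actM_injOn_ball hM).mono hDb) g]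
  refine setLIntegral_congr_fun hD fun z hz => ?_
  rw [det_restrictScalars_fderiv (hdiff z hz), abs_of_nonneg (Complex.normSq_nonneg _)]

end ChangeOfVariables

namespace T4Data

variable (X : T4Data)

/-- **THE TILING FOR `∫⁻`**: `∫⁻_𝔹 f = Σ′_φ ∫⁻_{φ D} f` for every `f ≥ 0` (no integrability needed). -/
theorem lintegral_ball_eq_tsum_image (K : X.Level) {D : Set (Fin 2 → ℂ)}
    (hD : IsFundamentalDomainFor (ballActions X.τ₀ X.C K.1) D) (f : (Fin 2 → ℂ) → ℝ≥0∞) :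
    ∫⁻ z in ball, f z = ∑' φ : ballActions X.τ₀ X.C K.1, ∫⁻ z in φ.1 '' D, f z := by
  have hτ : ∀ x, X.τ₀ (X.c x) = (starRingEnd ℂ) (X.τ₀ x) := fun x => complexConj_intertwines X.E X.τ₀ x
  haveI : Countable (ballActions X.τ₀ X.C K.1) := countable_ballActions
  have hmeas : ∀ φ : ballActions X.τ₀ X.C K.1, MeasurableSet (φ.1 '' D) := by
    intro φ
    obtain ⟨M, hM, hφ⟩ := exists_unitaryJ_of_mem_ballActions K.2.1 hτ X.hC φ.2
    rw [hφ]
    exact measurableSet_image_actM hM hD.1 hD.2.1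
  rw [setLIntegral_congr (ball_ae_eq_iUnion_image K.2.1 hτ X.hC hD)]
  exact lintegral_iUnion₀ (fun φ => (hmeas φ).nullMeasurableSet)
    (fun φ ψ hne => hD.2.2.2 φ.1 φ.2 ψ.1 ψ.2 (fun h => hne (Subtype.ext h))) f

/-- `∫⁻_S ‖kernel (g • x, ·)‖ₑ = ∫⁻_{M(g⁻¹) S} ‖kernel (x, ·)‖ₑ` for `g ∈ Γ′`. -/
theorem lintegral_kernel_mulVec_eq_image (D : X.ThetaData) (K : X.Level) {S : Set (Fin 2 → ℂ)}
    (hS : MeasurableSet S) (hSb : S ⊆ ball) (g : {γ : Matrix (Fin 3) (Fin 3) X.E // γ ∈ K.1}) (x : X.Tuple) :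
    ∫⁻ z in S, ‖X.kernel D.Φ (fun j => g.1 *ᵥ x j) z‖ₑ =
      ∫⁻ z in actM (toBallMat X.τ₀ X.C (X.invEquiv K g).1) '' S, ‖X.kernel D.Φ x z‖ₑ := by
  have hg' : (X.invEquiv K g).1 ∈ K.1 := (X.invEquiv K g).2
  have hu' : IsUnitaryOf X.c X.H (X.invEquiv K g).1 := isUnitaryOf_of_mem_level X K hg'
  have hM' : (toBallMat X.τ₀ X.C (X.invEquiv K g).1)ᴴ * J * toBallMat X.τ₀ X.C (X.invEquiv K g).1 = J :=
    toBallMat_J_of_unitary X hu'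
  rw [lintegral_image_actM hM' hS hSb]
  refine setLIntegral_congr_fun hS fun z hz => ?_
  have h := X.kernel_equiv D hu' (fun j => g.1 *ᵥ x j) (hSb hz)
  have hd : IsUnit g.1.det := by
    obtain ⟨g', hg', hgg', hg'g⟩ := exists_inv_mem K.2.1 g.2
    exact (Matrix.isUnit_iff_isUnit_det _).mp ⟨⟨g.1, g', hgg', hg'g⟩, rfl⟩
  have hx : (fun j => (X.invEquiv K g).1 *ᵥ (g.1 *ᵥ x j)) = x := by
    funext j
    show g.1⁻¹ *ᵥ (g.1 *ᵥ x j) = x j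
    rw [Matrix.mulVec_mulVec, Matrix.nonsing_inv_mul _ hd, Matrix.one_mulVec]
  rw [hx] at h
  show ‖X.kernel D.Φ (fun j => g.1 *ᵥ x j) z‖ₑ = _
  rw [h, enorm_mul, ← ofReal_norm (E := ℂ), Complex.norm_real, Real.norm_eq_abs,
    abs_of_nonneg (Complex.normSq_nonneg _)]

/-- **THE `Γ′`-SUM OF `∫⁻_D ‖kernel (g • x)‖ₑ` IS `|Z′| · ∫⁻_𝔹 ‖kernel x‖ₑ`**. -/
theorem tsum_lintegral_kernel_mulVec (D : X.ThetaData) (K : X.Level) {Dom : Set (Fin 2 → ℂ)}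
    (hD : IsFundamentalDomainFor (ballActions X.τ₀ X.C K.1) Dom) (x : X.Tuple) :
    ∑' g : {γ : Matrix (Fin 3) (Fin 3) X.E // γ ∈ K.1}, ∫⁻ z in Dom, ‖X.kernel D.Φ (fun j => g.1 *ᵥ x j) z‖ₑ =
      (X.centerCard K : ℝ≥0∞) * ∫⁻ z in ball, ‖X.kernel D.Φ x z‖ₑ := by
  have h1 : ∀ g : {γ : Matrix (Fin 3) (Fin 3) X.E // γ ∈ K.1},
      ∫⁻ z in Dom, ‖X.kernel D.Φ (fun j => g.1 *ᵥ x j) z‖ₑ =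
        ∫⁻ z in (X.actionMap K (X.invEquiv K g)).1 '' Dom, ‖X.kernel D.Φ x z‖ₑ :=
    fun g => X.lintegral_kernel_mulVec_eq_image D K hD.1 hD.2.1 g x
  simp_rw [h1]
  have h3 : (∑' g : {γ : Matrix (Fin 3) (Fin 3) X.E // γ ∈ K.1},
        ∫⁻ z in (X.actionMap K (X.invEquiv K g)).1 '' Dom, ‖X.kernel D.Φ x z‖ₑ) =
      ∑' g : {γ : Matrix (Fin 3) (Fin 3) X.E // γ ∈ K.1}, ∫⁻ z in (X.actionMap K g).1 '' Dom, ‖X.kernel D.Φ x z‖ₑ :=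
    (X.invEquiv K).tsum_eq (fun g => ∫⁻ z in (X.actionMap K g).1 '' Dom, ‖X.kernel D.Φ x z‖ₑ)
  rw [h3, tsum_comp_eq_ennreal (X.actionMap K) (fun φ : ballActions X.τ₀ X.C K.1 =>
    ∫⁻ z in φ.1 '' Dom, ‖X.kernel D.Φ x z‖ₑ)]
  haveI : ∀ φ : ballActions X.τ₀ X.C K.1,
      Finite {g : {γ : Matrix (Fin 3) (Fin 3) X.E // γ ∈ K.1} // X.actionMap K g = φ} := by
    intro φ
    obtain ⟨g₀, rfl⟩ := X.actionMap_surjective K φ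
    haveI := X.finite_centre K
    exact Finite.of_equiv _ (X.fibreEquivCentre K g₀).symm
  haveI : ∀ φ : ballActions X.τ₀ X.C K.1,
      Fintype {g : {γ : Matrix (Fin 3) (Fin 3) X.E // γ ∈ K.1} // X.actionMap K g = φ} :=
    fun φ => Fintype.ofFinite _
  have hcard : ∀ φ : ballActions X.τ₀ X.C K.1,
      (Fintype.card {g : {γ : Matrix (Fin 3) (Fin 3) X.E // γ ∈ K.1} // X.actionMap K g = φ} : ℝ≥0∞) =
        (X.centerCard K : ℝ≥0∞) := by
    intro φ
    obtain ⟨g₀, rfl⟩ := X.actionMap_surjective K φ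
    rw [Fintype.card_eq_nat_card, X.natCard_centreFibre K g₀]
  simp_rw [tsum_fibre_const (X.actionMap K), hcard]
  rw [ENNReal.tsum_mul_left, ← X.lintegral_ball_eq_tsum_image K hD]

/-! ## 2. Integrability of the kernel from the majorant -/

/-- The kernel of `x` is integrable on the ball when the kernel of `g • x` is (`g ∈ U(H)`). -/
theorem integrableOn_kernel_of_mulVec (D : X.ThetaData) {g : Matrix (Fin 3) (Fin 3) X.E}
    (hg : IsUnitaryOf X.c X.H g) (x : X.Tuple)
    (h : IntegrableOn (fun z => X.kernel D.Φ (fun j => g *ᵥ x j) z) ball) :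
    IntegrableOn (fun z => X.kernel D.Φ x z) ball := by
  have hgu : IsUnit g := by
    have h1 : IsUnit (cstar X.c g * X.H * g) := by
      unfold IsUnitaryOf at hg
      rw [hg]; exact isUnit_H X
    exact (IsUnit.mul_iff.mp h1).2
  have hgd : IsUnit g.det := (Matrix.isUnit_iff_isUnit_det g).mp hgu
  have h' := X.integrableOn_kernel_mulVec D (isUnitaryOf_inv X.c (isUnit_H X) hg) (fun j => g *ᵥ x j) h
  have hx : (fun j => g⁻¹ *ᵥ (g *ᵥ x j)) = x := by
    funext j
    rw [Matrix.mulVec_mulVec, Matrix.nonsing_inv_mul _ hgd, Matrix.one_mulVec]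
  rw [hx] at h'
  exact h'

/-- **INTEGRABILITY FROM THE MAJORANT**: for a main class `c` with `coefQ (x_c) ≠ 0`, the kernel of `x_c` is
integrable on the ball. -/
theorem integrableOn_kernel_of_coefQ_ne_zero (D : X.ThetaData) {K : X.Level} (γ : X.Tr K) (xm : X.Tuple)
    (hfin : ∀ c : X.MainClass K xm, Finite (X.Stab K (X.mainRep K xm c)))
    (hD : IsFundamentalDomainFor (ballActions X.τ₀ X.C K.1) (X.domain K))
    (h2 : (∀ z ∈ X.domain K, Summable fun w : X.LineTuple => ‖X.summand D.Φ D.cf γ w z‖) ∧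
      IntegrableOn (fun z => ∑' w : X.LineTuple, ‖X.summand D.Φ D.cf γ w z‖) (X.domain K))
    (c : X.MainClass K xm) (hc : X.coefQ D.cf γ (X.mainRep K xm c) ≠ 0) :
    IntegrableOn (fun z => X.kernel D.Φ (X.mainRep K xm c) z) ball := by
  haveI := hfin c
  have htot := X.lintegral_tsum_classKernel_ne_top D γ xm hfin hD h2
  rw [ENNReal.tsum_sigma'] at htot
  have hc' := ENNReal.ne_top_of_tsum_ne_top htot c
  -- the constant of the class
  obtain ⟨κ, hκ⟩ : ∃ κ : ℝ≥0∞,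
      κ = ‖((X.stabCard K (X.mainRep K xm c) : ℂ))⁻¹ * X.coefQ D.cf γ (X.mainRep K xm c)‖ₑ := ⟨_, rfl⟩
  have hκ0 : κ ≠ 0 := by
    rw [hκ, enorm_ne_zero]
    refine mul_ne_zero (inv_ne_zero ?_) hc
    exact_mod_cast X.stabCard_ne_zero K (X.mainRep K xm c)
  have hκt : κ ≠ ∞ := by rw [hκ]; exact enorm_ne_top
  have heq : ∀ g : {γ : Matrix (Fin 3) (Fin 3) X.E // γ ∈ K.1},
      ∫⁻ z in X.domain K, ‖X.classKernel D γ xm ⟨c, g⟩ z‖ₑ =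
        κ * ∫⁻ z in X.domain K, ‖X.kernel D.Φ (fun j => g.1 *ᵥ X.mainRep K xm c j) z‖ₑ := by
    intro g
    rw [← lintegral_const_mul' κ _ hκt]
    refine lintegral_congr fun z => ?_
    rw [hκ]
    unfold T4Data.classKernel
    rw [enorm_mul]
  simp_rw [heq] at hc'
  rw [ENNReal.tsum_mul_left, X.tsum_lintegral_kernel_mulVec D K hD (X.mainRep K xm c)] at hc'
  have hfin' : ∫⁻ z in ball, ‖X.kernel D.Φ (X.mainRep K xm c) z‖ₑ ≠ ∞ := by
    intro h
    rw [h] at hc'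
    have hn : (X.centerCard K : ℝ≥0∞) ≠ 0 := by exact_mod_cast X.centerCard_ne_zero K
    rw [ENNReal.mul_top hn, ENNReal.mul_top hκ0] at hc'
    exact hc' rfl
  refine ⟨(X.continuousOn_kernel D.Φ _).aestronglyMeasurable isOpen_ball.measurableSet, ?_⟩
  exact hasFiniteIntegral_iff_enorm.mpr (lt_top_iff_ne_top.mpr hfin')

/-! ## 3. L3.6a with exactly the skeleton's hypotheses -/

/-- **L3.6a (`term_main_unfold`), FINAL**: for `xm` with independent `xm 0, xm 1`, a fundamental domain `D` of the level
and the majorant `h2` of L3.2a, `term (Φ, cf, K, γ, [xm]) = (∫_𝔹 kernel xm) · classSum`.  (The skeleton's `hab` is the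
wedge form, converted by `linearIndependent_of_ballWedge`; its `h02 h13` are not needed.) -/
theorem term_main_unfold_final (D : X.ThetaData) (xm : X.Tuple) (hab : LinearIndependent X.E ![xm 0, xm 1])
    {K : X.Level} (γ : X.Tr K)
    (hD : IsFundamentalDomainFor (ballActions X.τ₀ X.C K.1) (X.domain K))
    (h2 : (∀ z ∈ X.domain K, Summable fun w : X.LineTuple => ‖X.summand D.Φ D.cf γ w z‖) ∧
      IntegrableOn (fun z => ∑' w : X.LineTuple, ‖X.summand D.Φ D.cf γ w z‖) (X.domain K)) :
    X.term D.Φ D.cf K γ (X.orbitOf (X.lines xm)) = (∫ z in ball, X.kernel D.Φ xm z) * X.classSum D.cf γ xm := by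
  have hfin : ∀ c : X.MainClass K xm, Finite (X.Stab K (X.mainRep K xm c)) :=
    fun c => X.finite_stab_mainRep K xm hab c
  by_cases hex : ∃ c : X.MainClass K xm, X.coefQ D.cf γ (X.mainRep K xm c) ≠ 0
  · obtain ⟨c, hc⟩ := hex
    have h1 := X.integrableOn_kernel_of_coefQ_ne_zero D γ xm hfin hD h2 c hc
    have h0 : IntegrableOn (fun z => X.kernel D.Φ xm z) ball :=
      X.integrableOn_kernel_of_mulVec D (X.gRep_isUnitaryOf K xm c) xm h1
    exact X.term_main_unfold_full' D xm hab γ hD h2 h0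
  · have hall : ∀ c : X.MainClass K xm, X.coefQ D.cf γ (X.mainRep K xm c) = 0 := fun c => by
      by_contra h
      exact hex ⟨c, h⟩
    unfold T4Data.term T4Data.classSum
    have hz : ∀ z ∈ X.domain K,
        ∑' w : {w : X.LineTuple // X.orbitOf w = X.orbitOf (X.lines xm)}, X.summand D.Φ D.cf γ w.1 z = 0 := by
      intro z hz
      rw [X.tsum_orbit_eq_tsum_classKernel D γ xm hfin z (h2.1 z hz)]
      simp only [T4Data.classKernel, hall, mul_zero, zero_mul, tsum_zero]
    rw [setIntegral_congr_fun hD.1 hz, integral_zero]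
    simp only [hall, mul_zero, tsum_zero]

/-- **L3.6a IN THE SKELETON'S FORM** (v0.28 `term_main_unfold`, with the wedge-form independence `hab` converted by
`linearIndependent_of_ballWedge` (t4-L3-p2, BallCoordLemmas p666667); the skeleton's `h02 h13` are not needed). -/
theorem term_main_unfold_of_wedge (D : X.ThetaData) (xm : X.Tuple)
    (hab : X.ballCoord (xm 0) 0 * X.ballCoord (xm 1) 1 - X.ballCoord (xm 0) 1 * X.ballCoord (xm 1) 0 ≠ 0)
    (K : X.Level) (γ : X.Tr K) (hD : IsFundamentalDomainFor (ballActions X.τ₀ X.C K.1) (X.domain K))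
    (h2 : (∀ z ∈ X.domain K, Summable (fun w : X.LineTuple => ‖X.summand D.Φ D.cf γ w z‖)) ∧
      IntegrableOn (fun z => ∑' w : X.LineTuple, ‖X.summand D.Φ D.cf γ w z‖) (X.domain K)) :
    X.term D.Φ D.cf K γ (X.orbitOf (X.lines xm)) = (∫ z in ball, X.kernel D.Φ xm z) * X.classSum D.cf γ xm :=
  X.term_main_unfold_final D xm (X.linearIndependent_of_ballWedge hab) γ hD h2

end T4Data

end Summit.Ventures.HodgeRepro.Tier4.Line3

end
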